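import Summits.BirchSwinnertonDyer.BirchSwinnertonDyer.Theorems.PrintCFramBottomClassIndexLawFiveLeRegularLocusCharTrivial
import Summits.BirchSwinnertonDyer.BirchSwinnertonDyer.Theorems.PrintCFramBottomClassIndexLawFiveLeEisensteinEndStatePrints7
import Summits.BirchSwinnertonDyer.BirchSwinnertonDyer.Theorems.SchneiderFreeAdditiveX3BranchIMCKrizLiLocus
import Summits.BirchSwinnertonDyer.BirchSwinnertonDyer.Theorems.AdditiveRankOneBSDpRowKernels
import HarnessLib

/-!
# Route `PrintCFram`, crux C2 `BottomClassIndexLawFiveLe` (stmt-BirchSwinnertonDyer-20372), line `eisenstein-resource-bdp-line`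
# (registry v5): the crux's conclusion ON THE REGULAR (Kriz–Li) LOCUS FROM PRINT ONLY — no main conjecture, neither research stub

Cell `bsd-print-cfram`, LEAD seat `bsd-line-cfram-p1` (generation g5), `--supports stmt-BirchSwinnertonDyer-20372` (helper).
HONEST FRAMING. The crux C2 is CLASS-WIDE and stays OPEN; its two research stubs (β1 `stub_flatEisensteinIncl_cmRamified`, (AN)
`stub_analyticInequality_cmRamified`) are NOT closed. What this file proves: at every `(W, p)` of the CM-ramified class (`W/ℚ`
globally minimal with CM, `p ≥ 5` CM-ramified, `r_an(W) = 1`) that carries a REGULAR KRIZ–LI HEEGNER DATUM — a Heegner field `K`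
of `N_W` with `d_K` odd `< −4` and `L(W^{(d_K)}, 1) ≠ 0`, Kriz–Li's binders `(ψ, ω, (1)–(3); ε_K, (4) B_{1,ψ₀⁻¹ε_K}·B_{1,ψ₀ω⁻¹} ≢ 0)`,
and ONE anticyclotomic frame `(κ, γ, 𝔭)` at which some residual line `Φ ≤ W_K[p]` (no `ker κ ⊓ D_𝔭`-fixed vector in the quotient)
has TRIVIAL residual Selmer groups `R_𝔭^S(K_∞, Φ) = R_𝔭^S(K_∞, W_K[p]/Φ) = 1` — the conclusion `RamifiedCMBottomClassIndexLawAtZp W p`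
of C2 holds, from PUBLISHED named facts only: Hsieh 2014 Thm. A, Liu–Zhang–Zhang 2018, `ToricPublishedInputs` (GZ, Kolyvagin, GZK,
modularity, GZ I.(7.3), …), Poitou–Tate for Ш, Burungale–Flach 2024 (rank-zero CM twist), Cassels, and Kriz–Li 2019 Thm. 1.20.
Mechanism (CGLS 2022 Thm. 5.3.1's «λ = 0» case, completed at the ADDITIVE supercuspidal prime where (h1) `p ∤ N` fails):
* control exponent `n = 0`: `XAc.HasCharValuationAt X_(∅,0) 0` from the trivial residual Selmer groups (companion file
  `…RegularLocusCharTrivial`, w2 g3's counted devissage);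
* UPPER socket `AdditiveIMCUpperBDPOnTreeLeAt … (v_p c) P` from `n = 0` and the INTEGRALITY of the ♭-BDP frame value
  `Q(𝟙) = u·(log_ω P / c)² ∈ 𝓞_{ℂ_p}` (Hsieh + LZZ, tree `exists_frameInt_value_manin`): `v_p(c) ≤ ord_p log_ω P`;
* LOWER socket `AdditiveIMCLowerBDPOnTreeLeAt … (v_p c) P` from Kriz–Li Thm. 1.20 BY NAME: `ord_p log_ω P ≤ v_p(c)` (tree
  `SchneiderFree.additiveIMCLowerBDPOnTreeLeAt_of_charTorsion_of_krizLi`, `|Ẽ^{ns}(𝔽_p)| = p` at the additive `p`);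
* exact control at the frame (LEAD g3's `additiveControl_heegner_of_cmRamified`: the `W(ℚ_p)[p] = 0` door), Kolyvagin ⟹ both index
  halves at slack `v_p(c)` (K1 links) ⟹ `BSDp W p` (`SchneiderFree.Exact.bsdp_of_exactIndexManin_of_partner_bsdp`, the partner's `BSD_p` by
  Burungale–Flach through `rankZeroTwistBSDp_of_hasCM`) ⟹ the index law (k7r-c4 `ramifiedCMBottomClassIndexLawAtZp_of_bsdp`).
READING. On this line the research content of C2 = {β1, (AN)} is needed only OFF the regular locus, i.e. where `λ(X_(∅,0)) ≥ 1` at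
every frame of every admissible Heegner datum (the IRREGULAR pairs). The regular locus is inhabited: w2 g0/g2 certified
`‖B_{1,ω^{121}}‖_{163} = ‖B_{1,χ_{−7}ω^{40}}‖_{163} = 1` (p609511, p611027) = hypothesis (4) for `(A(163), 163, ℚ(√−7))`; the
triviality of the two residual Selmer groups there is the quantitative CGLS Prop. 14 (Rubin IMC + μ = 0) at `λ = 0` — print for
characters, not typed in the tree, hence carried here as the hypothesis `hreg`.
BSD is not proved by any of this; no summit statement is proved by this seat.

References: Kriz–Li 2019 Thm. 1.20, Rem. 1.17, Rem. 1.21 [KrizLi2019]; Castella–Grossi–Lee–Skinner 2022 §3, Thm. 5.3.1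
[CastellaGrossiLeeSkinner2022]; Jetchev–Skinner–Wan 2017 §7.4.1 [JetchevSkinnerWan2017]; Hsieh 2014 Thm. A [Hsieh2014];
Liu–Zhang–Zhang 2018 Thms. 1.5.1/1.5.3 [LiuZhangZhang2018]; Burungale–Flach 2024 Cor. 2 [BurungaleFlach2024]; Gross–Zagier 1986
I.(6.3), I.(7.3) [GrossZagier1986].
-/

set_option autoImplicit false
-- the summit namespace `Summit.BirchSwinnertonDyer.BirchSwinnertonDyer` repeats the problem name by design (D-0017)
set_option linter.dupNamespace false

noncomputable section

open scoped Classical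

namespace Summit.BirchSwinnertonDyer.BirchSwinnertonDyer.Theorems.PrintCFram.RegularLocus

open WeierstrassCurve NumberField IsDedekindDomain Field PowerSeries
  Literature.NumberTheory.EllipticCurves Literature.NumberTheory.EllipticCurves.GreenbergSelmer
  Literature.NumberTheory.EllipticCurves.GreenbergVatsal2000
  Literature.NumberTheory.EllipticCurves.ModularForms
  Literature.NumberTheory.EllipticCurves.KrizLi2019
  Literature.NumberTheory.GaloisCohomology
  Literature.NumberTheory.EllipticCurves.Rank1Residual
  Literature.NumberTheory.EllipticCurves.Rank1Residual.Typed
  Literature.NumberTheory.GaloisRepresentations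
  Summit.BirchSwinnertonDyer.Rank1Residual
  Summit.BirchSwinnertonDyer.Rank1Residual.Additive
  Summit.BirchSwinnertonDyer.Rank1Residual.X11b Summit.BirchSwinnertonDyer.Rank1Residual.X11b.AcSelmer
  Summit.BirchSwinnertonDyer.Rank1Residual.X11b.Halves
  Summit.BirchSwinnertonDyer.Rank1Residual.X12
  Summit.BirchSwinnertonDyer.Rank1Residual.X2.ResidualDevissageModules
  Summit.BirchSwinnertonDyer.BirchSwinnertonDyer.Theses.UniversalToricDescent
  Summit.BirchSwinnertonDyer.BirchSwinnertonDyer.Theorems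
  Summit.BirchSwinnertonDyer.BirchSwinnertonDyer.Theorems.SchneiderFree
  Summit.BirchSwinnertonDyer.BirchSwinnertonDyer.Theorems.UniversalToricDescentWaldspurgerFlat
  Summit.BirchSwinnertonDyer.BirchSwinnertonDyer.Theorems.UniversalToricDescentStrictPlace
  Summit.BirchSwinnertonDyer.BirchSwinnertonDyer.Theorems.RamifiedSevenEllipticUnits
  Summit.BirchSwinnertonDyer.BirchSwinnertonDyer.Theorems.PrintCFram
  Summit.BirchSwinnertonDyer.BirchSwinnertonDyer.Theorems.PrintCFram.EisensteinResourceBdpLine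

/-! ## §1 The UPPER socket from a unit characteristic power series and the integrality of the ♭-frame value -/

section Upper

variable {p : ℕ} [Fact p.Prime] {K : Type} [Field K] [NumberField K]
  {W : WeierstrassCurve ℚ} [W.IsElliptic] [W.IsGloballyMinimal]

/-- **Integrality of the frame value ⟹ `v_p(c) ≤ ord_p log_ω P`.** If some `Q ∈ 𝓞_{ℂ_p}⟦T⟧` has value `u·(log_ω P / c)²` at `𝟙`
with `‖u‖ = 1`, `log_ω P ≠ 0` and `c ≠ 0`, then `‖log_ω P / c‖ ≤ 1`, i.e. `v_p(c) ≤ ord_p log_ω P` (`Q(𝟙) = Q(0) ∈ 𝓞_{ℂ_p}`).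
[cite: Hsieh2014, Thm. A p. 712 (Doc. Math. 19)] [cite: LiuZhangZhang2018, Thm 1.5.1 and Thm 1.5.3 (Duke Math. J. 167 pp. 748–749)] -/
theorem padicValInt_le_padicLogOrd_of_frameValue (ι : K →+* ℚ_[p]) (P : (W.baseChange K).toAffine.Point) {c : ℤ}
    {Q : PowerSeries (PadicComplexInt p)} {u : ℂ_[p]} (hu : ‖u‖ = 1)
    (hval : IntSeries.HasValueAt Q 0 (u * (algebraMap ℚ_[p] ℂ_[p] (logOmega W p ι P / (c : ℚ_[p]))) ^ 2))
    (hlog : logOmega W p ι P ≠ 0) (hc : c ≠ 0) :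
    (padicValInt p c : ℤ) ≤ X11b.padicLogOrd W p ι P := by
  have hp : p.Prime := Fact.out
  set x : ℚ_[p] := logOmega W p ι P / (c : ℚ_[p]) with hx
  have hc' : (c : ℚ_[p]) ≠ 0 := by exact_mod_cast hc
  have hx0 : x ≠ 0 := div_ne_zero hlog hc'
  have hQ0 : u * (algebraMap ℚ_[p] ℂ_[p] x) ^ 2 = ((constantCoeff Q : PadicComplexInt p) : ℂ_[p]) :=
    R1.intSeries_eq_constantCoeff_of_hasValueAt_zero p hval
  have hnorm : ‖x‖ ^ 2 ≤ 1 := by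
    calc ‖x‖ ^ 2 = ‖u‖ * ‖algebraMap ℚ_[p] ℂ_[p] x‖ ^ 2 := by rw [hu, one_mul, norm_algebraMap']
      _ = ‖((constantCoeff Q : PadicComplexInt p) : ℂ_[p])‖ := by rw [← norm_pow, ← norm_mul, hQ0]
      _ ≤ 1 := R1.norm_coe_padicComplexInt_le_one p _
  have hx1 : ‖x‖ ≤ 1 := by
    by_contra h
    push Not at h
    have : (1 : ℝ) < ‖x‖ ^ 2 := by nlinarith [norm_nonneg x]
    linarith
  have hp1 : (1 : ℝ) < p := by exact_mod_cast hp.one_lt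
  rw [Padic.norm_eq_zpow_neg_valuation hx0] at hx1
  have hv0 : 0 ≤ x.valuation := by
    by_contra hneg
    push Not at hneg
    have : (1 : ℝ) < (p : ℝ) ^ (-x.valuation) := one_lt_zpow₀ hp1 (by omega)
    linarith
  have hv : x.valuation = X11b.padicLogOrd W p ι P - (padicValInt p c : ℤ) := by
    rw [hx, div_eq_mul_inv, Padic.valuation_mul hlog (inv_ne_zero hc'), Padic.valuation_inv, Padic.valuation_intCast,
      valuation_logOmega hlog]
    ring
  rw [hv] at hv0
  omega

variable {κ : ZpExtension K p} {𝔭 : HeightOneSpectrum (𝓞 K)} {γ : Field.absoluteGaloisGroup K} [Fact (κ.IsTopGenerator γ)]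

/-- **The UPPER socket on the regular locus.** At a frame where `X_(∅,0)` has a characteristic power series with UNIT constant
term (`XAc.HasCharValuationAt … 0`) and where some ♭-frame value `Q(𝟙) = u·(log_ω P/c)²` is integral, the co-T-B6-1 socket
`AdditiveIMCUpperBDPOnTreeLeAt p κ 𝔭 γ ι (v_p c) P` holds: `0 + 2·v_p(c) ≤ 2·ord_p log_ω P`. No main conjecture is used.
[cite: JetchevSkinnerWan2017, §7.4.1 (arXiv:1512.06894 p. 30)] [cite: CastellaGrossiLeeSkinner2022, Thm. 5.3.1 (arXiv:2008.02571)] -/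
theorem additiveIMCUpperBDPOnTreeLeAt_of_hasCharValuationAt_zero_of_frameValue (ι : K →+* ℚ_[p])
    (P : (W.baseChange K).toAffine.Point) {c : ℤ} {Q : PowerSeries (PadicComplexInt p)} {u : ℂ_[p]}
    (h0 : XAc.HasCharValuationAt (W.baseChange K) p κ 𝔭 ∅ γ 0) (hu : ‖u‖ = 1)
    (hval : IntSeries.HasValueAt Q 0 (u * (algebraMap ℚ_[p] ℂ_[p] (logOmega W p ι P / (c : ℚ_[p]))) ^ 2))
    (hlog : logOmega W p ι P ≠ 0) (hc : c ≠ 0) :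
    Upper.AdditiveIMCUpperBDPOnTreeLeAt p κ 𝔭 γ ι (padicValNat p c.natAbs) P := by
  refine ⟨0, h0, ?_⟩
  have hle := padicValInt_le_padicLogOrd_of_frameValue ι P hu hval hlog hc
  have hcz : (padicValInt p c : ℤ) = (padicValNat p c.natAbs : ℤ) := rfl
  rw [hcz] at hle
  simp only [Nat.cast_zero, zero_add]
  omega

/-- **The LOWER socket on the regular locus, from Kriz–Li's conclusion** (the tree's
`SchneiderFree.additiveIMCLowerBDPOnTreeLeAt_of_charTorsion_of_krizLi` with CTL₀ fed by `n = 0`; recorded for symmetry).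
[cite: KrizLi2019, Thm. 1.20 (pp. 7–8) and Rem. 1.17 (p. 6)] -/
theorem additiveIMCLowerBDPOnTreeLeAt_of_hasCharValuationAt_zero_of_krizLi (ι : K →+* ℚ_[p])
    (P : (W.baseChange K).toAffine.Point) {c : ℤ}
    (h0 : XAc.HasCharValuationAt (W.baseChange K) p κ 𝔭 ∅ γ 0) (hadd : Addv W p)
    (hne : ¬ ‖((KrizLi2019.nsPointCount W p : ℤ) : ℚ_[p]) / (p : ℚ_[p]) *
        (Castella2018.padicLogOmega W p ι P / (c : ℚ_[p]))‖ ≤ (p : ℝ)⁻¹) :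
    AdditiveIMCLowerBDPOnTreeLeAt p κ 𝔭 γ ι (padicValNat p c.natAbs) P :=
  additiveIMCLowerBDPOnTreeLeAt_of_charTorsion_of_krizLi ⟨0, h0⟩ (nsPointCount_eq_self_of_addv hadd) hne

end Upper

/-! ## §2 Both index halves at a regular Kriz–Li datum of the CM-ramified class -/

section Datum

variable {p : ℕ} [Fact p.Prime]

/-- **Both index halves at slack `v_p(c)` at a REGULAR KRIZ–LI DATUM, CM-ramified class.** Inputs BY NAME: Hsieh 2014 Thm. A (`hA`),
Liu–Zhang–Zhang 2018 (`hL`), Poitou–Tate for Ш (`hPT2`), Kolyvagin (`hKo`), Kriz–Li 2019 Thm. 1.20 (`hKL`); the other four control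
facts are tree theorems (`prints_four_hold`). Data: `W` CM, `p ≥ 5` CM-ramified; a Heegner datum `(N = N_W, K, Dt, H, ι, P)` with
`d_K < −4`, `L(W^{(d_K)},1) ≠ 0`, `P` the non-torsion Heegner point; Kriz–Li's binders at `(W, p)` and `K` with (1), (3), (4) ((2) «no
split multiplicative prime» is automatic for CM); an anticyclotomic frame `(κ, γ, 𝔭 ∋ p)` carrying a residual line with trivial residual
Selmer groups (`hreg`). Conclusion: `IndexLowerBoundLeAt W p K P (v_p c) ∧ Upper.IndexUpperBoundLeAt W p K P (v_p c)`.
[cite: KrizLi2019, Thm. 1.20 (pp. 7–8), Rem. 1.17 (p. 6), Rem. 1.21 (p. 8)] [cite: JetchevSkinnerWan2017, §7.4.1 (arXiv:1512.06894 p. 30)]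
[cite: Hsieh2014, Thm. A p. 712 (Doc. Math. 19)] [cite: LiuZhangZhang2018, Thm 1.5.1 and Thm 1.5.3 (Duke Math. J. 167 pp. 748–749)] -/
theorem indexHalves_cmRamified_of_regularKrizLiDatum
    (hA : Hsieh2014.thmA_exists_isHsiehLFunction_unrPeriod_anyLevel)
    (hL : LiuZhangZhang2018.thm151_thm153_modularCurve_heegnerVector_additive)
    (hPT2 : ∀ (K : Type) [Field K] [NumberField K], poitouTate_sha_tateDual K)
    (hKo : ∀ (N : ℕ) [NeZero N] (W : WeierstrassCurve ℚ) (K : Type) [Field K] [NumberField K],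
      Literature.NumberTheory.EllipticCurves.kolyvagin N W K)
    (hKL : KrizLi2019.thm120_padicLogHeegner_unit_of_bernoulli)
    (W : WeierstrassCurve ℚ) [W.IsElliptic] [W.IsGloballyMinimal] (hCM : W.HasCM) (hram : CMRamified W p) (h5 : 5 ≤ p)
    (N : ℕ) [NeZero N] (K : Type) [Field K] [NumberField K]
    (Dt : ModularParametrizationData W N) (H : HeegnerDatum N (NumberField.discr K)) (ι : K →+* ℂ)
    (P : (W.baseChange K).toAffine.Point)
    (hN : W.conductorNorm ℤ = N) (hK : IsImaginaryQuadratic K) (hHN : SatisfiesHeegnerHypothesis N K)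
    (hd4 : NumberField.discr K < -4) (hLt : (W.quadraticTwist (NumberField.discr K : ℚ)).entireLFunction 1 ≠ 0)
    (hP : WeierstrassCurve.Affine.Point.map ι.toRatAlgHom P = heegnerPointComplex Dt H) (hnt : ¬ IsOfFinAddOrder P)
    -- Kriz–Li's binders at `(W, p)`
    (f : ℕ) [NeZero f] (ψ : DirichletCharacter ℚ_[p] f) (ω : DirichletCharacter ℚ_[p] p)
    (hψ : ψ.IsPrimitive) (hω : KrizLi2019.IsTeichmullerCharacter ω)
    (hss : ∀ ℓ : ℕ, ℓ.Prime → ¬ (ℓ ∣ p * W.conductorNorm ℤ) →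
      ‖((W.LFunction ℓ : ℤ) : ℚ_[p]) - (ψ (ℓ : ZMod f) + ψ⁻¹ (ℓ : ZMod f) * ω (ℓ : ZMod p))‖ < 1)
    (h1 : ψ (p : ZMod f) ≠ 1) (h1' : KrizLi2019.primVal (KrizLi2019.invMulOmega ψ ω) p ≠ 1)
    (h3 : ∀ ℓ : ℕ, (hℓ : ℓ.Prime) → ℓ ≠ p →
      (haveI := Fact.mk hℓ; ¬ W.HasGoodReductionAtPrime ℓ ∧ ¬ W.HasMultiplicativeReductionAtPrime ℓ) →
      ψ (ℓ : ZMod f) ≠ 1 ∧ KrizLi2019.primVal (KrizLi2019.invMulOmega ψ ω) ℓ ≠ 1)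
    -- Kriz–Li's binders at `K`
    (εK : DirichletCharacter ℚ_[p] (NumberField.discr K).natAbs) (hεK : KrizLi2019.IsKroneckerCharacterOf K εK)
    (h4 : ¬ (‖KrizLi2019.bernoulliOnePrim (KrizLi2019.bernoulliCharOne ψ εK) *
        KrizLi2019.bernoulliOnePrim (KrizLi2019.bernoulliCharTwo ψ εK ω)‖ ≤ (p : ℝ)⁻¹))
    -- the regular frame
    (κ : ZpExtension K p) (hκ : κ.IsAnticyclotomic) (γ : Field.absoluteGaloisGroup K) [Fact (κ.IsTopGenerator γ)]
    (𝔭 : HeightOneSpectrum (𝓞 K)) (h𝔭 : ((p : ℕ) : 𝓞 K) ∈ 𝔭.asIdeal)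
    (hreg : ∃ Φ : X2.ResidualDevissageModules.StableSubgroup (absoluteGaloisGroup K) ((W.baseChange K).geomTorsion (p : ℤ)),
      (∀ y : Φ.Quot, (∀ g : ↥(κ.kerSubgroup ⊓ decomp 𝔭), g • y = y) → y = 0) ∧
      Nat.card (datumStrictSelmer κ.kerSubgroup Φ.Sub p (AcSelmer.bdpData Φ.Sub p 𝔭)
          {v : HeightOneSpectrum (𝓞 K) | ¬ (W.baseChange K).HasGoodReductionAt v ∧ ((p : ℕ) : 𝓞 K) ∉ v.asIdeal}) = 1 ∧
      Nat.card (datumStrictSelmer κ.kerSubgroup Φ.Quot p (AcSelmer.bdpData Φ.Quot p 𝔭)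
          {v : HeightOneSpectrum (𝓞 K) | ¬ (W.baseChange K).HasGoodReductionAt v ∧ ((p : ℕ) : 𝓞 K) ∉ v.asIdeal}) = 1) :
    IndexLowerBoundLeAt W p K P (padicValNat p Dt.c.natAbs) ∧
      Upper.IndexUpperBoundLeAt W p K P (padicValNat p Dt.c.natAbs) := by
  have hp : p.Prime := Fact.out
  have hp2 : p ≠ 2 := by omega
  obtain ⟨hPT, hEP, hcd, hBr⟩ := EisensteinResourceBdpLine.prints_four_hold
  have hadd : Addv W p := addv_of_cmRamified W hCM hram h5
  have hpN : p ∣ N := by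
    rw [← hN]; exact (W.dvd_conductorNorm_iff_not_hasGoodReductionAtPrime p).mpr hadd.1
  have hp2N : p ^ 2 ∣ N := by
    rw [← hN]
    by_contra h
    rcases hasGoodReductionAtPrime_or_hasMultiplicativeReductionAtPrime_of_not_sq_dvd_conductorNorm (V := W) h
      with hg | hm
    · exact hadd.1 hg
    · exact hadd.2 hm
  obtain ⟨he, hf⟩ := degreeOne_of_dvd_of_heegner hK hHN hpN h𝔭
  obtain ⟨_, hfin⟩ := hKo N W K hK hHN ⟨Dt, H, ι, hP⟩ hnt
  -- control exponent `n = 0` at the regular frame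
  have h0 : XAc.HasCharValuationAt (W.baseChange K) p κ 𝔭 ∅ γ 0 :=
    hasCharValuationAt_zero_cmRamified_of_regular W hCM hram h5 hN hK hHN κ γ 𝔭 h𝔭 hreg
  -- exact control at the frame (the `W(ℚ_p)[p] = 0` door)
  have hCtl : AdditiveControlOnTreeAt p κ 𝔭 γ (embAt K p 𝔭 h𝔭 he hf) P :=
    additiveControl_heegner_of_cmRamified hPT hPT2 hEP hcd hBr W hCM hram h5 N K Dt H ι P hN hK hHN hLt hP hnt
      (hKo N W K) κ hκ γ 𝔭 h𝔭 he hf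
  -- the ♭-frame at `𝔭` and its integral value (Hsieh + LZZ)
  obtain ⟨ι₀⟩ := PadicAlgCl.nonempty_ringEquiv_complex p
  obtain ⟨ι', -, hind⟩ := exists_datum_forall_mem_iff p ι₀ hK h𝔭
  obtain ⟨ΩK, Ωp', Q, -, -, u, hu, hval⟩ :=
    exists_frameInt_value_manin hA hL W K 𝔭 κ γ Dt H ι P hp2 hN hp2N hK hd4 h𝔭 he hf hHN hκ hP hnt ι' hind
  have hc0 : Dt.c ≠ 0 := Dt.maninConstant_ne_zero_holds
  have hlog : logOmega W p (embAt K p 𝔭 h𝔭 he hf) P ≠ 0 := X11b.R1.logOmega_ne_zero W p _ hnt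
  -- UPPER socket from `n = 0` + integrality
  have hup : Upper.AdditiveIMCUpperBDPOnTreeLeAt p κ 𝔭 γ (embAt K p 𝔭 h𝔭 he hf) (padicValNat p Dt.c.natAbs) P :=
    additiveIMCUpperBDPOnTreeLeAt_of_hasCharValuationAt_zero_of_frameValue _ P h0 hu hval hlog hc0
  -- LOWER socket from Kriz–Li Thm. 1.20 by name
  have h2 : ∀ ℓ : ℕ, (hℓ : ℓ.Prime) → ¬ (haveI := Fact.mk hℓ; W.HasSplitMultiplicativeReductionAtPrime ℓ) :=
    fun ℓ hℓ hsp ↦ by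
      haveI := Fact.mk hℓ
      exact W.not_hasMultiplicativeReductionAtPrime_of_hasCM hCM ℓ hsp.hasMultiplicativeReductionAtPrime
  have hlow : AdditiveIMCLowerBDPOnTreeLeAt p κ 𝔭 γ (embAt K p 𝔭 h𝔭 he hf) (padicValNat p Dt.c.natAbs) P := by
    subst hN
    haveI : NeZero (NumberField.discr K).natAbs := ⟨Int.natAbs_ne_zero.mpr (NumberField.discr_ne_zero K)⟩
    have hsplit : ((Ideal.span {(p : ℤ)}).primesOver (𝓞 K)).ncard = 2 := hHN p hp hpN
    have hne := hKL p hp2 W f ψ ω hψ hω hss h1 h1' h2 h3 Dt K hK hHN hsplit εK hεK H ι (embAt K p 𝔭 h𝔭 he hf) P hP h4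
    exact additiveIMCLowerBDPOnTreeLeAt_of_hasCharValuationAt_zero_of_krizLi _ P h0 hadd hne
  exact ⟨SchneiderFreeAdditiveX3.indexLowerBoundLeAt_of_imcLowerLe_of_control hN hK hHN hfin hlow hCtl,
    Upper.indexUpperBoundLeAt_of_imcUpperLe_of_control hN hK hHN hfin hup hCtl⟩

end Datum

/-! ## §3 `BSD_p(W)` and the crux's conclusion at a regular Kriz–Li datum, from print only -/

section Assembly

variable {p : ℕ} [Fact p.Prime]

/-- **`BSD_p(W)` at a REGULAR KRIZ–LI DATUM of the CM-ramified class, from PUBLISHED facts only.** The seven citations of the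
line's `stub_prints` (Hsieh 2014 Thm. A, LZZ 2018, `ToricPublishedInputs`, Poitou–Tate for Ш, Burungale–Flach 2024 / Rubin,
modularity, Cassels) plus Kriz–Li 2019 Thm. 1.20, and the regular datum of `indexHalves_cmRamified_of_regularKrizLiDatum` with
`d_K` odd: both index halves at slack `v_p(c)`, the partner `BSD_p` of a globally minimal model of `W^{(d_K)}` (CM, rank zero:
Burungale–Flach), then `SchneiderFree.Exact.bsdp_of_exactIndexManin_of_partner_bsdp`. Non-torsion of `P` is Gross–Zagier (`r_an = 1`,
`L(W^{(d_K)},1) ≠ 0`). CONDITIONAL on the named facts; no main conjecture, neither research stub of the line.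
[cite: KrizLi2019, Thm. 1.20 (pp. 7–8)] [cite: GrossZagier1986, Thm. I.(6.3) and (7.3)] [cite: BurungaleFlach2024, Thm. 1.1 and Cor. 2]
[cite: JetchevSkinnerWan2017, §7.4.1 (arXiv:1512.06894 p. 30)] -/
theorem bsdp_cmRamified_of_regularKrizLiDatum
    (hprints : Hsieh2014.thmA_exists_isHsiehLFunction_unrPeriod_anyLevel ∧
      LiuZhangZhang2018.thm151_thm153_modularCurve_heegnerVector_additive ∧
      ToricPublishedInputs ∧
      (∀ (K : Type) [Field K] [NumberField K], poitouTate_sha_tateDual K) ∧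
      bsdTriple_of_hasCM_of_L_one_ne_zero ∧ hasEntireLFunction_rat ∧ bsdRHS_eq_of_isIsogenous)
    (hKL : KrizLi2019.thm120_padicLogHeegner_unit_of_bernoulli)
    (W : WeierstrassCurve ℚ) [W.IsElliptic] [W.IsGloballyMinimal] (hCM : W.HasCM) (hram : CMRamified W p) (h5 : 5 ≤ p)
    (hr : W.analyticRank = 1)
    (N : ℕ) [NeZero N] (K : Type) [Field K] [NumberField K]
    (Dt : ModularParametrizationData W N) (H : HeegnerDatum N (NumberField.discr K)) (ι : K →+* ℂ)
    (P : (W.baseChange K).toAffine.Point)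
    (hN : W.conductorNorm ℤ = N) (hK : IsImaginaryQuadratic K) (hHN : SatisfiesHeegnerHypothesis N K)
    (hodd : Odd (NumberField.discr K)) (hd4 : NumberField.discr K < -4)
    (hLt : (W.quadraticTwist (NumberField.discr K : ℚ)).entireLFunction 1 ≠ 0)
    (hP : WeierstrassCurve.Affine.Point.map ι.toRatAlgHom P = heegnerPointComplex Dt H)
    (f : ℕ) [NeZero f] (ψ : DirichletCharacter ℚ_[p] f) (ω : DirichletCharacter ℚ_[p] p)
    (hψ : ψ.IsPrimitive) (hω : KrizLi2019.IsTeichmullerCharacter ω)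
    (hss : ∀ ℓ : ℕ, ℓ.Prime → ¬ (ℓ ∣ p * W.conductorNorm ℤ) →
      ‖((W.LFunction ℓ : ℤ) : ℚ_[p]) - (ψ (ℓ : ZMod f) + ψ⁻¹ (ℓ : ZMod f) * ω (ℓ : ZMod p))‖ < 1)
    (h1 : ψ (p : ZMod f) ≠ 1) (h1' : KrizLi2019.primVal (KrizLi2019.invMulOmega ψ ω) p ≠ 1)
    (h3 : ∀ ℓ : ℕ, (hℓ : ℓ.Prime) → ℓ ≠ p →
      (haveI := Fact.mk hℓ; ¬ W.HasGoodReductionAtPrime ℓ ∧ ¬ W.HasMultiplicativeReductionAtPrime ℓ) →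
      ψ (ℓ : ZMod f) ≠ 1 ∧ KrizLi2019.primVal (KrizLi2019.invMulOmega ψ ω) ℓ ≠ 1)
    (εK : DirichletCharacter ℚ_[p] (NumberField.discr K).natAbs) (hεK : KrizLi2019.IsKroneckerCharacterOf K εK)
    (h4 : ¬ (‖KrizLi2019.bernoulliOnePrim (KrizLi2019.bernoulliCharOne ψ εK) *
        KrizLi2019.bernoulliOnePrim (KrizLi2019.bernoulliCharTwo ψ εK ω)‖ ≤ (p : ℝ)⁻¹))
    (κ : ZpExtension K p) (hκ : κ.IsAnticyclotomic) (γ : Field.absoluteGaloisGroup K) [Fact (κ.IsTopGenerator γ)]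
    (𝔭 : HeightOneSpectrum (𝓞 K)) (h𝔭 : ((p : ℕ) : 𝓞 K) ∈ 𝔭.asIdeal)
    (hreg : ∃ Φ : X2.ResidualDevissageModules.StableSubgroup (absoluteGaloisGroup K) ((W.baseChange K).geomTorsion (p : ℤ)),
      (∀ y : Φ.Quot, (∀ g : ↥(κ.kerSubgroup ⊓ decomp 𝔭), g • y = y) → y = 0) ∧
      Nat.card (datumStrictSelmer κ.kerSubgroup Φ.Sub p (AcSelmer.bdpData Φ.Sub p 𝔭)
          {v : HeightOneSpectrum (𝓞 K) | ¬ (W.baseChange K).HasGoodReductionAt v ∧ ((p : ℕ) : 𝓞 K) ∉ v.asIdeal}) = 1 ∧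
      Nat.card (datumStrictSelmer κ.kerSubgroup Φ.Quot p (AcSelmer.bdpData Φ.Quot p 𝔭)
          {v : HeightOneSpectrum (𝓞 K) | ¬ (W.baseChange K).HasGoodReductionAt v ∧ ((p : ℕ) : 𝓞 K) ∉ v.asIdeal}) = 1) :
    BSDp W p := by
  have hp : p.Prime := Fact.out
  have hp2 : p ≠ 2 := by omega
  subst hN
  obtain ⟨hA, hL, hF, hPT2, hBF, hmod, -⟩ := hprints
  obtain ⟨hGZ, hKo, hGZK, -, -, -, hGZ73, -, -, -⟩ := hF
  have hadd : Addv W p := addv_of_cmRamified W hCM hram h5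
  have hpN : p ∣ W.conductorNorm ℤ := (W.dvd_conductorNorm_iff_not_hasGoodReductionAtPrime p).mpr hadd.1
  -- the Heegner point is non-torsion (Gross–Zagier at `r_an(E/K) = 1`)
  have hL0 : W.entireLFunction 1 = 0 := entireLFunction_one_eq_zero_of_analyticRank_eq_one hr
  obtain ⟨-, hderiv⟩ := leadingLCoeff_eq_deriv_of_analyticRank_eq_one hr
  have hLK : LDerivEK W K ≠ 0 := by
    rw [lDerivEK_eq_deriv_mul W K hmod hL0]; exact mul_ne_zero hderiv hLt
  have hnt : ¬ IsOfFinAddOrder P :=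
    (lDerivEK_ne_zero_iff_not_isOfFinAddOrder W (W.conductorNorm ℤ) K (hGZ _ W K) hK hHN ⟨Dt, H, ι, hP⟩).mp hLK
  -- both index halves at the regular Kriz–Li datum
  obtain ⟨hlo, hupI⟩ := indexHalves_cmRamified_of_regularKrizLiDatum hA hL hPT2 hKo hKL W hCM hram h5 (W.conductorNorm ℤ) K
    Dt H ι P rfl hK hHN hd4 hLt hP hnt f ψ ω hψ hω hss h1 h1' h3 εK hεK h4 κ hκ γ 𝔭 h𝔭 hreg
  -- `p ∤ #𝓞_K^×` (`d_K < −4`)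
  have hw : ¬ p ∣ Units.torsionOrder K := by
    rw [Literature.NumberTheory.QuadraticFields.Quadratic.torsionOrder_eq_two_of_discr_lt_neg_four hK.1 hd4]
    intro h
    exact hp2 ((Nat.prime_dvd_prime_iff_eq hp Nat.prime_two).mp h)
  -- the rank-zero partner: a globally minimal model of the twist and its `BSD_p` (Burungale–Flach)
  have hD0 : (NumberField.discr K : ℚ) ≠ 0 := by exact_mod_cast NumberField.discr_ne_zero K
  haveI : (W.quadraticTwist (NumberField.discr K : ℚ)).IsElliptic := W.isElliptic_quadraticTwist hD0
  obtain ⟨Cd, hCd⟩ := hasGlobalMinimalModel_rat_holds (W.quadraticTwist (NumberField.discr K : ℚ))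
  haveI : (Cd • W.quadraticTwist (NumberField.discr K : ℚ)).IsGloballyMinimal := hCd
  have hWd : BSDp (Cd • W.quadraticTwist (NumberField.discr K : ℚ)) p :=
    rankZeroTwistBSDp_of_hasCM hBF hmod W hCM (W.conductorNorm ℤ) K (Cd • W.quadraticTwist (NumberField.discr K : ℚ)) rfl hK
      hHN ⟨Cd, rfl⟩ hLt
  exact SchneiderFree.Exact.bsdp_of_exactIndexManin_of_partner_bsdp hGZ hKo hGZK hmod hGZ73 W p (W.conductorNorm ℤ) K Dt H ι P
    (Cd • W.quadraticTwist (NumberField.discr K : ℚ)) hr rfl hpN hK hodd hw hHN hLt hP ⟨Cd, rfl⟩ hp2 hlo hupI hWd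

/-- **C2's conclusion `RamifiedCMBottomClassIndexLawAtZp W p` at a REGULAR KRIZ–LI DATUM, from PUBLISHED facts only** (the
seven citations of `stub_prints` ∧ Kriz–Li Thm. 1.20; GZK is inside `ToricPublishedInputs`): `bsdp_cmRamified_of_regularKrizLiDatum`
then k7r-c4's `ramifiedCMBottomClassIndexLawAtZp_of_bsdp` (Cassels, modularity, GZK). This is the crux `BottomClassIndexLawFiveLe`
RESTRICTED to the regular locus; the class-wide crux stays open (research stubs β1/(AN) off the locus). CONDITIONAL on the named
facts. [cite: KrizLi2019, Thm. 1.20 (pp. 7–8), Rem. 1.21 (p. 8)] [cite: Miller2011LMS, Def. 1.1 (arXiv:1010.2431 p. 3)]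
[cite: CastellaGrossiLeeSkinner2022, Thm. 5.3.1 (arXiv:2008.02571)] -/
theorem ramifiedCMBottomClassIndexLawAtZp_of_regularKrizLiDatum
    (hprints : Hsieh2014.thmA_exists_isHsiehLFunction_unrPeriod_anyLevel ∧
      LiuZhangZhang2018.thm151_thm153_modularCurve_heegnerVector_additive ∧
      ToricPublishedInputs ∧
      (∀ (K : Type) [Field K] [NumberField K], poitouTate_sha_tateDual K) ∧
      bsdTriple_of_hasCM_of_L_one_ne_zero ∧ hasEntireLFunction_rat ∧ bsdRHS_eq_of_isIsogenous)
    (hKL : KrizLi2019.thm120_padicLogHeegner_unit_of_bernoulli)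
    (W : WeierstrassCurve ℚ) [W.IsElliptic] [W.IsGloballyMinimal] (hCM : W.HasCM) (hram : CMRamified W p) (h5 : 5 ≤ p)
    (hr : W.analyticRank = 1)
    (N : ℕ) [NeZero N] (K : Type) [Field K] [NumberField K]
    (Dt : ModularParametrizationData W N) (H : HeegnerDatum N (NumberField.discr K)) (ι : K →+* ℂ)
    (P : (W.baseChange K).toAffine.Point)
    (hN : W.conductorNorm ℤ = N) (hK : IsImaginaryQuadratic K) (hHN : SatisfiesHeegnerHypothesis N K)
    (hodd : Odd (NumberField.discr K)) (hd4 : NumberField.discr K < -4)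
    (hLt : (W.quadraticTwist (NumberField.discr K : ℚ)).entireLFunction 1 ≠ 0)
    (hP : WeierstrassCurve.Affine.Point.map ι.toRatAlgHom P = heegnerPointComplex Dt H)
    (f : ℕ) [NeZero f] (ψ : DirichletCharacter ℚ_[p] f) (ω : DirichletCharacter ℚ_[p] p)
    (hψ : ψ.IsPrimitive) (hω : KrizLi2019.IsTeichmullerCharacter ω)
    (hss : ∀ ℓ : ℕ, ℓ.Prime → ¬ (ℓ ∣ p * W.conductorNorm ℤ) →
      ‖((W.LFunction ℓ : ℤ) : ℚ_[p]) - (ψ (ℓ : ZMod f) + ψ⁻¹ (ℓ : ZMod f) * ω (ℓ : ZMod p))‖ < 1)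
    (h1 : ψ (p : ZMod f) ≠ 1) (h1' : KrizLi2019.primVal (KrizLi2019.invMulOmega ψ ω) p ≠ 1)
    (h3 : ∀ ℓ : ℕ, (hℓ : ℓ.Prime) → ℓ ≠ p →
      (haveI := Fact.mk hℓ; ¬ W.HasGoodReductionAtPrime ℓ ∧ ¬ W.HasMultiplicativeReductionAtPrime ℓ) →
      ψ (ℓ : ZMod f) ≠ 1 ∧ KrizLi2019.primVal (KrizLi2019.invMulOmega ψ ω) ℓ ≠ 1)
    (εK : DirichletCharacter ℚ_[p] (NumberField.discr K).natAbs) (hεK : KrizLi2019.IsKroneckerCharacterOf K εK)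
    (h4 : ¬ (‖KrizLi2019.bernoulliOnePrim (KrizLi2019.bernoulliCharOne ψ εK) *
        KrizLi2019.bernoulliOnePrim (KrizLi2019.bernoulliCharTwo ψ εK ω)‖ ≤ (p : ℝ)⁻¹))
    (κ : ZpExtension K p) (hκ : κ.IsAnticyclotomic) (γ : Field.absoluteGaloisGroup K) [Fact (κ.IsTopGenerator γ)]
    (𝔭 : HeightOneSpectrum (𝓞 K)) (h𝔭 : ((p : ℕ) : 𝓞 K) ∈ 𝔭.asIdeal)
    (hreg : ∃ Φ : X2.ResidualDevissageModules.StableSubgroup (absoluteGaloisGroup K) ((W.baseChange K).geomTorsion (p : ℤ)),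
      (∀ y : Φ.Quot, (∀ g : ↥(κ.kerSubgroup ⊓ decomp 𝔭), g • y = y) → y = 0) ∧
      Nat.card (datumStrictSelmer κ.kerSubgroup Φ.Sub p (AcSelmer.bdpData Φ.Sub p 𝔭)
          {v : HeightOneSpectrum (𝓞 K) | ¬ (W.baseChange K).HasGoodReductionAt v ∧ ((p : ℕ) : 𝓞 K) ∉ v.asIdeal}) = 1 ∧
      Nat.card (datumStrictSelmer κ.kerSubgroup Φ.Quot p (AcSelmer.bdpData Φ.Quot p 𝔭)
          {v : HeightOneSpectrum (𝓞 K) | ¬ (W.baseChange K).HasGoodReductionAt v ∧ ((p : ℕ) : 𝓞 K) ∉ v.asIdeal}) = 1) :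
    X12.O11.RamifiedCMBottomClassIndexLawAtZp W p := by
  have hpr := hprints
  obtain ⟨-, -, ⟨-, -, hGZK, -⟩, -, -, hmod, hCassels⟩ := hpr
  exact RubinFormulaZpBsdp.ramifiedCMBottomClassIndexLawAtZp_of_bsdp hCassels hmod hGZK hr.le
    (bsdp_cmRamified_of_regularKrizLiDatum hprints hKL W hCM hram h5 hr N K Dt H ι P hN hK hHN hodd hd4 hLt hP f ψ ω hψ hω hss
      h1 h1' h3 εK hεK h4 κ hκ γ 𝔭 h𝔭 hreg)

end Assembly

end Summit.BirchSwinnertonDyer.BirchSwinnertonDyer.Theorems.PrintCFram.RegularLocus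

end
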